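import Summits.BirchSwinnertonDyer.BirchSwinnertonDyer.Theorems.PrintCf2DisegniPairTwoQuotientLawValuationOdd
import Summits.BirchSwinnertonDyer.BirchSwinnertonDyer.Theorems.PrintCf2DisegniPairTwoShaAnBookkeeping
import HarnessLib

/-!
# Road (C) `disegni-pair-two` on crux stmt-BirchSwinnertonDyer-20368 — the defect key of the ODD classes
# `χ₋₄∘N` (`d* = −1`) and `χ₋₈∘N` (`d* = −2`) MODULO (Δ1) and the period ratio

Cell `bsd-print-cf2`, width seat `bsd-line-cf2-p1-w8` g23; sequel of `PrintCf2DisegniPairTwoQuotientLawValuationOdd.lean`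
and `PrintCf2DisegniPairTwoShaAnBookkeeping.lean` (the `χ₈∘N`-class twin is `shaAn_valuation_chi8` there).
`--supports stmt-BirchSwinnertonDyer-20368` (helper). THEOREMS ONLY (no `def`, no named fact, no `sorry`); conditional
on every displayed hypothesis (Gross–Zagier I.(7.3) as the named-fact hypothesis `GrossZagier1986_thm_I_7_3`). BSD
is not proved by any of this; no summit statement is claimed; 20368 is not closed here.

## What is proved

★★★ `shaAn_valuation_chi4` (`d* = −1`) and ★★★ `shaAn_valuation_chi8'` (`d* = −2`): frame and hypotheses of
`quotient_law_chi4_companion_free` / `quotient_law_chi8'_companion_free` (with `L(W,1) = 0`, `L′(W,1) ≠ 0` DERIVED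
from `r_an(W) = 1`), plus Gross–Zagier I.(7.3), `rank W(ℚ) = 1`, `C • W = V^{(d*)}` (the explicit model carrying
the generator `P`), the period input `Ω(W)·(τ(χ)·i) = l·Ω⁻_f` (`l ∈ ℚ`; `τ(χ₋₄)·i = −2`, `τ(χ₋₈)·i = −2√2`)
and `h₂ ≠ 0` (Bertrand). Conclusion: `D ≠ 0` and `shaAn W = q ∈ ℚ^×` with
`v₂(q) + v₂(l) + v₂(Tam W) + v₂(h₂) = v₂(D) + 2 + 2·v₂(#W(ℚ)_tors)`,
`D = [T¹]L₂⁻(f,ω,T)` resp. `L₂⁻′(f,ω,−2)` — the class's defect key MODULO the (Δ1) law for `v₂(D) − v₂(h₂)` and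
the class constant `v₂(l)` (assembled from `shaAn_bookkeeping_of_generator` and `quotient_law_chi4_valuation` /
`quotient_law_chi8'_valuation`).

References: D. Disegni, Compos. Math. 153 (2017) Thm. B [Disegni2017]; B. Gross, D. Zagier, Invent. Math. 84 (1986)
Thm. I.(7.3) [GrossZagier1986]; B. Perrin-Riou, Invent. Math. 89 (1987) §1 [PerrinRiou1987]; R. L. Miller, LMS J.
Comput. Math. 14 (2011) §1 [Miller2011LMS].
-/

set_option autoImplicit false
set_option linter.dupNamespace false

noncomputable section

open scoped Classical MatrixGroups ModularForm NumberField

open CongruenceSubgroup NumberField IsDedekindDomain WeierstrassCurve WeierstrassCurve.Affine.Point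
  Literature.NumberTheory.EllipticCurves Literature.NumberTheory.EllipticCurves.ModularForms
  Literature.NumberTheory.EllipticCurves.Disegni2017 Literature.NumberTheory.GaloisRepresentations
  Summit.BirchSwinnertonDyer.Rank1Residual.AdditivePotMult

namespace Summit.BirchSwinnertonDyer.BirchSwinnertonDyer.Theorems.PrintCf2.DisegniPairTwo

variable (ι : PadicAlgCl 2 ≃+* ℂ) (K : Type) [Field K] [NumberField K] [IsGalois ℚ K]

/-- ★★★ **The defect key of the `χ₋₄∘N`-class (`d* = −1`) MODULO (Δ1) and the period ratio, BY NAME**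
(module docstring): `D ≠ 0` and `shaAn W = q ∈ ℚ^×` with
`v₂(q) + v₂(l) + v₂(Tam W) + v₂(h₂) = v₂(D) + 2 + 2·v₂(#W(ℚ)_tors)`; period input `Ω(W)·(τ(χ₋₄)·i) = l·Ω⁻_f`
(`τ(χ₋₄)·i = −2`). [cite: Disegni2017, Theorem B (arXiv v3 PDF p. 8)] [cite: GrossZagier1986, Thm. I.(7.3)]
[cite: PerrinRiou1987, §1] [cite: Miller2011LMS, §1] -/
theorem shaAn_valuation_chi4 (hGZ73 : GrossZagier1986_thm_I_7_3) (h2 : Module.finrank ℚ K = 2)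
    (hsplit : ((Ideal.span {(2 : ℤ)}).primesOver (𝓞 K)).ncard = 2)
    (𝔭 𝔭' : HeightOneSpectrum (𝓞 K)) (h𝔭 : ((2 : ℕ) : 𝓞 K) ∈ 𝔭.asIdeal)
    (h𝔭' : ((2 : ℕ) : 𝓞 K) ∈ 𝔭'.asIdeal)
    (κ : DirichletCharacter ℂ (NumberField.discr K).natAbs)
    (hκ : ∀ ℓ : ℕ, ℓ.Prime → ℓ ≠ 2 → κ ℓ = (jacobiSym (NumberField.discr K) ℓ : ℂ))
    (hκ2 : κ 2 = if NumberField.discr K % 8 = 1 then 1 else if NumberField.discr K % 8 = 5 then -1 else 0)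
    (hd : Nat.Coprime 2 (NumberField.discr K).natAbs)
    (V V' : WeierstrassCurve ℚ) [V.IsElliptic] [V.IsGloballyMinimal] [V'.IsElliptic] [V'.IsGloballyMinimal]
    (hordV : IsOrdinaryAt V 2) (hordV' : IsOrdinaryAt V' 2) (hap : V'.frobeniusTrace 2 = V.frobeniusTrace 2)
    {N N' : ℕ} [NeZero N] [NeZero N'] {f : CuspForm (Gamma0 N) 2}
    {f' : CuspForm (Gamma0 N') 2} (hfV : IsNewformOf V f) (hfV' : IsNewformOf V' f')
    (hV' : ∀ n : ℕ, cuspCoeff f' n = κ (n : ZMod _) * cuspCoeff f n)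
    (h0 : PowerSeries.constantCoeff (padicLFunctionMinusBranch f (unitRoot V 2 : ℚ_[2]) 1) = 0)
    (hmod : hasEntireLFunction_rat) {M M' : ℕ} [NeZero M] [NeZero M']
    {g : CuspForm (Gamma0 M) 2} {g' : CuspForm (Gamma0 M') 2}
    (W W' : WeierstrassCurve ℚ) [W.IsElliptic] [W'.IsElliptic]
    (hg : IsNewformOf W g) (hg' : IsNewformOf W' g')
    (hgε : ∀ m : ℕ, cuspCoeff g m = (ZMod.χ₄.ringHomComp (Int.castRingHom ℂ)) m * cuspCoeff f m)
    (hg'ε : ∀ m : ℕ, cuspCoeff g' m = (ZMod.χ₄.ringHomComp (Int.castRingHom ℂ)) m * cuspCoeff f' m)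
    (hr : W.analyticRank = 1) (hrk : W.mordellWeilRank = 1) (hL' : W'.entireLFunction 1 ≠ 0)
    {H : Type} [Field H] [NumberField H] [Algebra K H] (hKH : Module.finrank K H = 2) {t : H}
    (htK : t ∉ Set.range (algebraMap K H)) (ht2 : t ^ 2 = algebraMap ℚ H (-1))
    (G : Subgroup (H ≃ₐ[ℚ] H)) (χ : G →* ℂˣ) (s : G → ℤ) (hs : ∀ σ, ((χ σ : ℂˣ) : ℂ) = (s σ : ℂ))
    (τ : H ≃ₐ[ℚ] H) (hτG : τ ∈ G) (hsτ : s ⟨τ, hτG⟩ = -1)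
    (hτK : ∀ a : K, τ (algebraMap K H a) = algebraMap K H a) (hτt : τ t = -t)
    {u : K} {e : ℚ} (hu : u ∉ Set.range (algebraMap ℚ K)) (hue : u ^ 2 = algebraMap ℚ K e)
    (c : K ≃ₐ[ℚ] K) (hcu : c u = -u)
    [(V.quadraticTwist (-1)).IsElliptic] {C : VariableChange ℚ} (hC : C • W = V.quadraticTwist (-1))
    {P : (V.quadraticTwist (-1)).toAffine.Point}
    (hgen : ∀ R : (V.quadraticTwist (-1)).toAffine.Point,
      ∃ (k : ℤ) (T : (V.quadraticTwist (-1)).toAffine.Point), IsOfFinAddOrder T ∧ R = k • P + T)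
    (htors : ∀ Q : ((V.quadraticTwist (-1)).quadraticTwist e).toAffine.Point, IsOfFinAddOrder Q)
    (DH : PAdicHeightDataK V 2 H)
    (hDH : ∀ (σ : G) (a b : (V.baseChange H).toAffine.Point),
      DH.pairing (pointGalHom V H σ.1 a) (pointGalHom V H σ.1 b) = DH.pairing a b)
    {h₂ : ℚ_[2]}
    (hpin : DH.pairing
      (twistPointEquivOver V (not_mem_range_rat_of_not_mem_range htK) ht2
        (QuadraticDescent.incl H (V.quadraticTwist (-1)) P))
      (twistPointEquivOver V (not_mem_range_rat_of_not_mem_range htK) ht2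
        (QuadraticDescent.incl H (V.quadraticTwist (-1)) P)) = h₂)
    (hGZ : ChiLineGrossZagierClauses ι K V H f (ι (((unitRoot V 2 : ℚ_[2]) : PadicAlgCl 2)))
      (baseChangeDirichlet K (ZMod.χ₄.ringHomComp (Int.castRingHom ℂ))) 𝔭 𝔭' G χ DH)
    -- the ONE period-ratio input (Pal 2012 + Manin + isogeny; class constant `v₂(l)`)
    {l : ℚ} (hl : (W.realPeriodRat : ℂ) *
      (gaussSum (ZMod.χ₄.ringHomComp (Int.castRingHom ℂ) : DirichletCharacter ℂ (2 ^ 2))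
        (ZMod.stdAddChar (N := 2 ^ 2)) * Complex.I) = (l : ℂ) * (minusPeriod f : ℂ))
    -- Bertrand: the 2-adic height of the member's generator is non-zero
    (hh₂ : h₂ ≠ 0) :
    PowerSeries.coeff 1 (padicLFunctionMinusBranch f (unitRoot V 2 : ℚ_[2]) 1) ≠ 0 ∧
    ∃ q : ℚ, shaAn W = (q : ℂ) ∧ q ≠ 0 ∧
      padicValRat 2 q + padicValRat 2 l + (padicValNat 2 W.tamagawaProduct : ℤ) + h₂.valuation =
        (PowerSeries.coeff 1 (padicLFunctionMinusBranch f (unitRoot V 2 : ℚ_[2]) 1)).valuation + 2 +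
          2 * (padicValNat 2 W.torsionOrder : ℤ) := by
  -- `L(W,1) = 0`, `L′(W,1) ≠ 0` from analytic rank one
  have hW1 : W.entireLFunction 1 = 0 := entireLFunction_one_eq_zero_of_analyticRank_eq_one hr
  have hL : deriv W.entireLFunction 1 ≠ 0 := (leadingLCoeff_eq_deriv_of_analyticRank_eq_one hr).2
  -- the rationality input `ρ` and the bookkeeping (`y = τ·i ≠ 0`)
  have hτ : gaussSum (ZMod.χ₄.ringHomComp (Int.castRingHom ℂ) : DirichletCharacter ℂ (2 ^ 2))
        (ZMod.stdAddChar (N := 2 ^ 2)) ≠ 0 :=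
    gaussSum_stdAddChar_ne_zero chi4_isPrimitive
  obtain ⟨ρ, hρ, -, q, hq, hq0, hval⟩ := shaAn_bookkeeping_of_generator (p := 2) hGZ73 W hr hrk hC hgen
    (mul_ne_zero hτ Complex.I_ne_zero) hl
  have hρ' : deriv W.entireLFunction 1 *
      gaussSum (ZMod.χ₄.ringHomComp (Int.castRingHom ℂ) : DirichletCharacter ℂ (2 ^ 2))
        (ZMod.stdAddChar (N := 2 ^ 2)) * Complex.I =
        (ρ : ℂ) * (canonicalHeight P : ℂ) * (minusPeriod f : ℂ) := by
    rw [mul_assoc]; exact hρ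
  -- the valuation equation of the quotient law
  obtain ⟨hD, hvD⟩ := quotient_law_chi4_valuation ι K h2 hsplit 𝔭 𝔭' h𝔭 h𝔭' κ hκ hκ2 hd V V' hordV hordV'
    hap hfV hfV' hV' h0 hmod W W' hg hg' hgε hg'ε hW1 hL hL' hKH htK ht2 G χ s hs τ hτG hsτ hτK hτt hu hue c
    hcu hgen htors DH hDH hpin hGZ ρ hρ' hh₂
  refine ⟨hD, q, hq, hq0, ?_⟩
  linear_combination hval - hvD

/-- ★★★ **The defect key of the `χ₋₈∘N`-class (`d* = −2`) MODULO (Δ1) and the period ratio, BY NAME**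
(module docstring): `D ≠ 0` and `shaAn W = q ∈ ℚ^×` with
`v₂(q) + v₂(l) + v₂(Tam W) + v₂(h₂) = v₂(D) + 2 + 2·v₂(#W(ℚ)_tors)`; period input `Ω(W)·(τ(χ₋₈)·i) = l·Ω⁻_f`
(`τ(χ₋₈)·i = −2√2`). [cite: Disegni2017, Theorem B (arXiv v3 PDF p. 8)] [cite: GrossZagier1986, Thm. I.(7.3)]
[cite: PerrinRiou1987, §1] [cite: Miller2011LMS, §1] -/
theorem shaAn_valuation_chi8' (hGZ73 : GrossZagier1986_thm_I_7_3) (h2 : Module.finrank ℚ K = 2)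
    (hsplit : ((Ideal.span {(2 : ℤ)}).primesOver (𝓞 K)).ncard = 2)
    (𝔭 𝔭' : HeightOneSpectrum (𝓞 K)) (h𝔭 : ((2 : ℕ) : 𝓞 K) ∈ 𝔭.asIdeal)
    (h𝔭' : ((2 : ℕ) : 𝓞 K) ∈ 𝔭'.asIdeal)
    (κ : DirichletCharacter ℂ (NumberField.discr K).natAbs)
    (hκ : ∀ ℓ : ℕ, ℓ.Prime → ℓ ≠ 2 → κ ℓ = (jacobiSym (NumberField.discr K) ℓ : ℂ))
    (hκ2 : κ 2 = if NumberField.discr K % 8 = 1 then 1 else if NumberField.discr K % 8 = 5 then -1 else 0)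
    (hd : Nat.Coprime 2 (NumberField.discr K).natAbs)
    (V V' : WeierstrassCurve ℚ) [V.IsElliptic] [V.IsGloballyMinimal] [V'.IsElliptic] [V'.IsGloballyMinimal]
    (hordV : IsOrdinaryAt V 2) (hordV' : IsOrdinaryAt V' 2) (hap : V'.frobeniusTrace 2 = V.frobeniusTrace 2)
    {N N' : ℕ} [NeZero N] [NeZero N'] {f : CuspForm (Gamma0 N) 2}
    {f' : CuspForm (Gamma0 N') 2} (hfV : IsNewformOf V f) (hfV' : IsNewformOf V' f')
    (hV' : ∀ n : ℕ, cuspCoeff f' n = κ (n : ZMod _) * cuspCoeff f n)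
    (h0 : HasSum (fun k : ℕ ↦ PowerSeries.coeff k (padicLFunctionMinusBranch f (unitRoot V 2 : ℚ_[2]) 1) *
      (-2 : ℚ_[2]) ^ k) 0)
    (hmod : hasEntireLFunction_rat) {M M' : ℕ} [NeZero M] [NeZero M']
    {g : CuspForm (Gamma0 M) 2} {g' : CuspForm (Gamma0 M') 2}
    (W W' : WeierstrassCurve ℚ) [W.IsElliptic] [W'.IsElliptic]
    (hg : IsNewformOf W g) (hg' : IsNewformOf W' g')
    (hgε : ∀ m : ℕ, cuspCoeff g m = (ZMod.χ₈'.ringHomComp (Int.castRingHom ℂ)) m * cuspCoeff f m)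
    (hg'ε : ∀ m : ℕ, cuspCoeff g' m = (ZMod.χ₈'.ringHomComp (Int.castRingHom ℂ)) m * cuspCoeff f' m)
    (hr : W.analyticRank = 1) (hrk : W.mordellWeilRank = 1) (hL' : W'.entireLFunction 1 ≠ 0)
    {H : Type} [Field H] [NumberField H] [Algebra K H] (hKH : Module.finrank K H = 2) {t : H}
    (htK : t ∉ Set.range (algebraMap K H)) (ht2 : t ^ 2 = algebraMap ℚ H (-2))
    (G : Subgroup (H ≃ₐ[ℚ] H)) (χ : G →* ℂˣ) (s : G → ℤ) (hs : ∀ σ, ((χ σ : ℂˣ) : ℂ) = (s σ : ℂ))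
    (τ : H ≃ₐ[ℚ] H) (hτG : τ ∈ G) (hsτ : s ⟨τ, hτG⟩ = -1)
    (hτK : ∀ a : K, τ (algebraMap K H a) = algebraMap K H a) (hτt : τ t = -t)
    {u : K} {e : ℚ} (hu : u ∉ Set.range (algebraMap ℚ K)) (hue : u ^ 2 = algebraMap ℚ K e)
    (c : K ≃ₐ[ℚ] K) (hcu : c u = -u)
    [(V.quadraticTwist (-2)).IsElliptic] {C : VariableChange ℚ} (hC : C • W = V.quadraticTwist (-2))
    {P : (V.quadraticTwist (-2)).toAffine.Point}
    (hgen : ∀ R : (V.quadraticTwist (-2)).toAffine.Point,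
      ∃ (k : ℤ) (T : (V.quadraticTwist (-2)).toAffine.Point), IsOfFinAddOrder T ∧ R = k • P + T)
    (htors : ∀ Q : ((V.quadraticTwist (-2)).quadraticTwist e).toAffine.Point, IsOfFinAddOrder Q)
    (DH : PAdicHeightDataK V 2 H)
    (hDH : ∀ (σ : G) (a b : (V.baseChange H).toAffine.Point),
      DH.pairing (pointGalHom V H σ.1 a) (pointGalHom V H σ.1 b) = DH.pairing a b)
    {h₂ : ℚ_[2]}
    (hpin : DH.pairing
      (twistPointEquivOver V (not_mem_range_rat_of_not_mem_range htK) ht2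
        (QuadraticDescent.incl H (V.quadraticTwist (-2)) P))
      (twistPointEquivOver V (not_mem_range_rat_of_not_mem_range htK) ht2
        (QuadraticDescent.incl H (V.quadraticTwist (-2)) P)) = h₂)
    (hGZ : ChiLineGrossZagierClauses ι K V H f (ι (((unitRoot V 2 : ℚ_[2]) : PadicAlgCl 2)))
      (baseChangeDirichlet K (ZMod.χ₈'.ringHomComp (Int.castRingHom ℂ))) 𝔭 𝔭' G χ DH)
    -- the ONE period-ratio input (Pal 2012 + Manin + isogeny; class constant `v₂(l)`)
    {l : ℚ} (hl : (W.realPeriodRat : ℂ) *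
      (gaussSum (ZMod.χ₈'.ringHomComp (Int.castRingHom ℂ) : DirichletCharacter ℂ (2 ^ (2 + 1)))
        (ZMod.stdAddChar (N := 2 ^ (2 + 1))) * Complex.I) = (l : ℂ) * (minusPeriod f : ℂ))
    -- Bertrand: the 2-adic height of the member's generator is non-zero
    (hh₂ : h₂ ≠ 0) :
    (∑' k : ℕ, PowerSeries.coeff k
        (padicLFunctionMinusBranch f (unitRoot V 2 : ℚ_[2]) 1) * (k : ℚ_[2]) * (-2) ^ (k - 1)) ≠ 0 ∧
    ∃ q : ℚ, shaAn W = (q : ℂ) ∧ q ≠ 0 ∧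
      padicValRat 2 q + padicValRat 2 l + (padicValNat 2 W.tamagawaProduct : ℤ) + h₂.valuation =
        ((∑' k : ℕ, PowerSeries.coeff k
        (padicLFunctionMinusBranch f (unitRoot V 2 : ℚ_[2]) 1) * (k : ℚ_[2]) * (-2) ^ (k - 1))).valuation + 2 +
          2 * (padicValNat 2 W.torsionOrder : ℤ) := by
  -- `L(W,1) = 0`, `L′(W,1) ≠ 0` from analytic rank one
  have hW1 : W.entireLFunction 1 = 0 := entireLFunction_one_eq_zero_of_analyticRank_eq_one hr
  have hL : deriv W.entireLFunction 1 ≠ 0 := (leadingLCoeff_eq_deriv_of_analyticRank_eq_one hr).2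
  -- the rationality input `ρ` and the bookkeeping (`y = τ·i ≠ 0`)
  have hτ : gaussSum (ZMod.χ₈'.ringHomComp (Int.castRingHom ℂ) : DirichletCharacter ℂ (2 ^ (2 + 1)))
        (ZMod.stdAddChar (N := 2 ^ (2 + 1))) ≠ 0 :=
    gaussSum_stdAddChar_ne_zero isPrimitive_χ₈'_ringHomComp
  obtain ⟨ρ, hρ, -, q, hq, hq0, hval⟩ := shaAn_bookkeeping_of_generator (p := 2) hGZ73 W hr hrk hC hgen
    (mul_ne_zero hτ Complex.I_ne_zero) hl
  have hρ' : deriv W.entireLFunction 1 *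
      gaussSum (ZMod.χ₈'.ringHomComp (Int.castRingHom ℂ) : DirichletCharacter ℂ (2 ^ (2 + 1)))
        (ZMod.stdAddChar (N := 2 ^ (2 + 1))) * Complex.I =
        (ρ : ℂ) * (canonicalHeight P : ℂ) * (minusPeriod f : ℂ) := by
    rw [mul_assoc]; exact hρ
  -- the valuation equation of the quotient law
  obtain ⟨hD, hvD⟩ := quotient_law_chi8'_valuation ι K h2 hsplit 𝔭 𝔭' h𝔭 h𝔭' κ hκ hκ2 hd V V' hordV hordV'
    hap hfV hfV' hV' h0 hmod W W' hg hg' hgε hg'ε hW1 hL hL' hKH htK ht2 G χ s hs τ hτG hsτ hτK hτt hu hue c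
    hcu hgen htors DH hDH hpin hGZ ρ hρ' hh₂
  refine ⟨hD, q, hq, hq0, ?_⟩
  linear_combination hval - hvD

end Summit.BirchSwinnertonDyer.BirchSwinnertonDyer.Theorems.PrintCf2.DisegniPairTwo

end
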